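import Summits.NavierStokesRegularity.NavierStokesRegularity.Theorems.CoriolisHeadCounterRotatingLiouvilleStokesRound
import Summits.NavierStokesRegularity.NavierStokesRegularity.Theorems.CoriolisHeadCounterRotatingLiouvilleLocalPressure
import Literature.Analysis.FluidPDE.TsaiPressureGrowth
import Literature.Analysis.FluidPDE.StokesInteriorEstimateHolds
import Literature.Analysis.FluidPDE.TsaiProfileEndgame

/-!
# Route CoriolisHead · crux `CounterRotatingLiouville` (stmt-NavierStokesRegularity-22677) —
# stub 2 `stub_rssHeadGrowth`: polynomial growth of the rotating head pressure

Support file of the line `tsai-rotating-head-chain` (theorems only; `--supports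
stmt-NavierStokesRegularity-22677`).  Last part of the port of Tsai's Lemma 3.2 chain to BOUNDED
rotated profiles `−νΔU + aU + a(y·∇)U + (BU − (By·∇)U) + (U·∇)U + ∇P = 0`, `div U = 0`, `B` skew:

* `stokes_round_of_rotated` — one Stokes–Sobolev round: from the `L²` local pressure control at
  radius `1000R` (`exists_local_pressure_bound_of_four_le_of_rotated`, `q = ∞`), Lemma 3.1, the
  body-force bound for bounded `U`, the interior Stokes estimate (`stokes_interior_Lr_estimate_holds`)
  and interior GNS give polynomial bounds for `‖DU‖_{L²}`, `‖D²U‖_{L²}` on `B(x₀, 9R)`,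
  `‖DU‖_{L⁶(B(x₀,3R))}`, together with the trivial `L⁶`, `L^{12}` bounds of the bounded `U`;
* `exists_osc_pressure_le_of_rotated` — `osc_{B̄(x₀,1)} P ≤ K (1 + |x₀|)⁶` (harmonic part by the
  gradient bound, localised normalised pressure by the tree's `exists_poly_bound_sup_localPressure`);
* `exists_pressure_growth_of_rotated` — `|P(y)| ≤ C |y|⁷` for `|y| ≥ 1`;
* `stub_rssHeadGrowth` — `|Π_B(y)| ≤ C (1 + |y|)^N` for the rotating head
  `Π_B = ½|U|² + P + a⟨y,U⟩ − ⟨By,U⟩` of a smooth bounded rotated profile (the registered stub).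

NS regularity is NOT proved here.
-/

noncomputable section

-- the summit and its single sub-problem share the name (CONVENTIONS §1), as in every Theorems file
set_option linter.dupNamespace false

open MeasureTheory Set Function Filter Topology InnerProductSpace Metric
open scoped RealInnerProductSpace Laplacian ContDiff BigOperators ENNReal NNReal
open Literature.Analysis.FluidPDE

namespace Summit.NavierStokesRegularity.NavierStokesRegularity.Theorems.CoriolisHead

section Growth

-- nested operator types `ℝ³ →L[ℝ] ℝ³ →L[ℝ] ℝ³`
set_option maxSynthPendingDepth 3

variable {ν a : ℝ} {B : EuclideanSpace ℝ (Fin 3) →L[ℝ] EuclideanSpace ℝ (Fin 3)}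
  {U : (EuclideanSpace ℝ (Fin 3)) → (EuclideanSpace ℝ (Fin 3))} {P : (EuclideanSpace ℝ (Fin 3)) → ℝ}

/-- **One Stokes–Sobolev round for a bounded rotated profile.** For `U ∈ C^∞` bounded, `P ∈ C²`,
`B` skew, `ν > 0`, `a ≥ 0`, `R > 0` and an `L²` local pressure control
`‖P − c_{x₀}‖_{L²(B(x₀,1000R))} ≤ K_P (1 + |x₀|)`, the local norms `‖DU‖_{L²(B(x₀,9R))}`,
`‖U‖_{L⁶(B(x₀,9R))}`, `‖D²U‖_{L²(B(x₀,9R))}`, `‖DU‖_{L⁶(B(x₀,3R))}`, `‖U‖_{L^{12}(B(x₀,R))}` are all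
bounded by `K (1 + |x₀|)³` uniformly in the centre (same output shape as the tree's
`IsLerayProfile.bootstrap`; for bounded `U` one round suffices). -/
theorem stokes_round_of_rotated (hSt : stokes_interior_Lr_estimate) (hU : ContDiff ℝ ∞ U)
    (hP2 : ContDiff ℝ 2 P) (hB : ∀ x, ⟪B x, x⟫ = 0) (hdiv : VectorCalculus.IsDivFree U)
    (heq : ∀ y, -(ν • (Δ U) y) + a • U y + a • fderiv ℝ U y y + (B (U y) - fderiv ℝ U y (B y)) +
      convect U U y + gradient P y = 0)
    (hν : 0 < ν) (ha : 0 ≤ a) {M : ℝ} (hM : ∀ y, ‖U y‖ ≤ M) {R : ℝ} (hR : 0 < R)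
    {c : (EuclideanSpace ℝ (Fin 3)) → ℝ} {K_P : ℝ} (hK_P : 0 ≤ K_P)
    (hPc : ∀ x₀ : (EuclideanSpace ℝ (Fin 3)), eLpNorm (fun x => P x - c x₀) 2
      (volume.restrict (ball x₀ (1000 * R))) ≤ ENNReal.ofReal (K_P * (1 + ‖x₀‖))) :
    ∃ K : ℝ, 0 ≤ K ∧ ∀ x₀ : (EuclideanSpace ℝ (Fin 3)),
      eLpNorm (fun x => fderiv ℝ U x) 2 (volume.restrict (ball x₀ (9 * R))) ≤
          ENNReal.ofReal (K * (1 + ‖x₀‖) ^ 3) ∧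
      eLpNorm U 6 (volume.restrict (ball x₀ (9 * R))) ≤ ENNReal.ofReal (K * (1 + ‖x₀‖) ^ 3) ∧
      eLpNorm (fun x => iteratedFDeriv ℝ 2 U x) 2 (volume.restrict (ball x₀ (9 * R))) ≤
          ENNReal.ofReal (K * (1 + ‖x₀‖) ^ 3) ∧
      eLpNorm (fun x => fderiv ℝ U x) 6 (volume.restrict (ball x₀ (3 * R))) ≤
          ENNReal.ofReal (K * (1 + ‖x₀‖) ^ 3) ∧
      eLpNorm U 12 (volume.restrict (ball x₀ R)) ≤ ENNReal.ofReal (K * (1 + ‖x₀‖) ^ 3) := by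
  have hUc : Continuous U := hU.continuous
  have hU1 : ContDiff ℝ 1 U := hU.of_le (by norm_cast)
  have hP1 : ContDiff ℝ 1 P := hP2.of_le one_le_two
  have hDUc : Continuous fun x => fderiv ℝ U x := hU1.continuous_fderiv one_ne_zero
  have hM0 : 0 ≤ M := (norm_nonneg _).trans (hM 0)
  have hUq : MemLp U ∞ volume := memLp_top_of_bound hUc.aestronglyMeasurable M (Eventually.of_forall hM)
  have ht0 : ∀ x₀ : (EuclideanSpace ℝ (Fin 3)), 0 ≤ ‖x₀‖ := fun x₀ => norm_nonneg _
  -- the `L^{3/2}` pressure control from the `L²` one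
  have h32one : (1 : ℝ≥0∞) ≤ ENNReal.ofReal (3 / 2) := by
    rw [← ENNReal.ofReal_one]; exact ENNReal.ofReal_le_ofReal (by norm_num)
  have h32two : ENNReal.ofReal (3 / 2) ≤ 2 := by
    rw [← ENNReal.ofReal_ofNat]; exact ENNReal.ofReal_le_ofReal (by norm_num)
  have hPc1 : ∀ x₀ : (EuclideanSpace ℝ (Fin 3)), eLpNorm (fun x => P x - c x₀) 2
      (volume.restrict (ball x₀ (1000 * R))) ≤ ENNReal.ofReal (K_P * (1 + ‖x₀‖) ^ 1) := fun x₀ => by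
    rw [pow_one]; exact hPc x₀
  obtain ⟨K_P', hK_P', hPc32⟩ := exists_poly_bound_of_exponent_le' (f := fun x₀ x => P x - c x₀)
    (fun x₀ => (hP1.continuous.sub continuous_const).aestronglyMeasurable) h32one h32two (1000 * R)
    hK_P hPc1
  have hPc32' : ∀ x₀ : (EuclideanSpace ℝ (Fin 3)), eLpNorm (fun x => P x - c x₀) (ENNReal.ofReal (3 / 2))
      (volume.restrict (ball x₀ (1000 * R))) ≤ ENNReal.ofReal (K_P' * (1 + ‖x₀‖)) := fun x₀ => by
    have := hPc32 x₀; rwa [pow_one] at this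
  -- S1: `DU ∈ L²(324R)`, degree 1
  obtain ⟨K₁, hK₁, hS1⟩ := exists_eLpNorm_fderiv_two_le_of_rotated hU hP2 hB hdiv heq hν ha (q := ∞)
    le_top hUq hR hK_P' hPc32'
  have hDU2 : ∀ x₀ : (EuclideanSpace ℝ (Fin 3)), eLpNorm (fun x => fderiv ℝ U x) 2
      (volume.restrict (ball x₀ (18 * R))) ≤ ENNReal.ofReal (K₁ * (1 + ‖x₀‖) ^ 1) := fun x₀ => by
    rw [pow_one]; exact (eLpNorm_restrict_ball_mono _ _ x₀ (by linarith)).trans (hS1 x₀)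
  -- uniform `U ∈ L²(18R)`, `U ∈ L⁶(9R)`, `U ∈ L^{12}(R)`
  obtain ⟨CU2, hCU20, hCU2⟩ := exists_eLpNorm_restrict_ball_le_of_memLp hUc hUq (s := 2) (by norm_num)
    le_top (18 * R)
  obtain ⟨CU6, hCU60, hCU6⟩ := exists_eLpNorm_restrict_ball_le_of_memLp hUc hUq (s := 6) (by norm_num)
    le_top (9 * R)
  obtain ⟨CU12, hCU120, hCU12⟩ := exists_eLpNorm_restrict_ball_le_of_memLp hUc hUq (s := 12) (by norm_num)
    le_top R
  -- S2: `F ∈ L²(18R)`, degree 2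
  obtain ⟨KF, hKF, hF⟩ := exists_poly_bound_bodyForce_of_rotated hU1 a B hM (by positivity : 0 < 18 * R)
    (p := 2) one_le_two hCU20 hK₁ (m₁ := 0) (m₂ := 1) (poly_zero_of_uniform hCU2 0 hCU20) hDU2
  have hdeg : max 0 (1 + 1) = 2 := by norm_num
  rw [hdeg] at hF
  -- S3: Stokes at `r = 2`, `S = 9R`
  have h18 : (18 : ℝ) * R = 2 * (9 * R) := by ring
  have hF2 : ∀ x₀ : (EuclideanSpace ℝ (Fin 3)), eLpNorm (fun x => a • U x + a • fderiv ℝ U x x +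
      (B (U x) - fderiv ℝ U x (B x)) + convect U U x) 2 (volume.restrict (ball x₀ (2 * (9 * R)))) ≤
      ENNReal.ofReal (KF * (1 + ‖x₀‖) ^ 2) := fun x₀ => by rw [← h18]; exact hF x₀
  have hU2' : ∀ x₀ : (EuclideanSpace ℝ (Fin 3)), eLpNorm U 2 (volume.restrict (ball x₀ (2 * (9 * R)))) ≤
      ENNReal.ofReal (CU2 * (1 + ‖x₀‖) ^ 2) := fun x₀ => by
    rw [← h18]; exact poly_zero_of_uniform hCU2 2 hCU20 x₀
  have hDU2' : ∀ x₀ : (EuclideanSpace ℝ (Fin 3)), eLpNorm (fun x => fderiv ℝ U x) 2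
      (volume.restrict (ball x₀ (2 * (9 * R)))) ≤ ENNReal.ofReal (K₁ * (1 + ‖x₀‖) ^ 2) := fun x₀ => by
    rw [← h18]; exact (hDU2 x₀).trans (ofReal_poly_le_of_le hK₁ (ht0 x₀) (by norm_num))
  have hP2' : ∀ x₀ : (EuclideanSpace ℝ (Fin 3)), eLpNorm (fun x => P x - c x₀) 2
      (volume.restrict (ball x₀ (2 * (9 * R)))) ≤ ENNReal.ofReal (K_P * (1 + ‖x₀‖) ^ 2) := fun x₀ => by
    rw [← h18]
    exact ((eLpNorm_restrict_ball_mono _ _ x₀ (by linarith)).trans (hPc1 x₀)).trans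
      (ofReal_poly_le_of_le hK_P (ht0 x₀) (by norm_num))
  obtain ⟨K₂, hK₂, hS3⟩ := exists_poly_bound_stokes_of_rotated hSt hU hP2 hdiv heq hν (r := 2)
    (by norm_num) (by norm_num) (by positivity : 0 < 9 * R) hKF hCU20 hK₁ hK_P hF2 hU2' hDU2' hP2'
  -- S4: Sobolev `2 → 6` for `DU` at `s = 3R`
  have h9 : (9 : ℝ) * R = 3 * (3 * R) := by ring
  have hD2U : ∀ x₀ : (EuclideanSpace ℝ (Fin 3)), eLpNorm (fun x => iteratedFDeriv ℝ 2 U x) ((2 : ℝ≥0) : ℝ≥0∞)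
      (volume.restrict (ball x₀ (3 * (3 * R)))) ≤ ENNReal.ofReal (K₂ * (1 + ‖x₀‖) ^ 2) := fun x₀ => by
    rw [← h9]; exact_mod_cast (hS3 x₀).1
  have hDU9 : ∀ x₀ : (EuclideanSpace ℝ (Fin 3)), eLpNorm (fun x => fderiv ℝ U x) ((2 : ℝ≥0) : ℝ≥0∞)
      (volume.restrict (ball x₀ (3 * (3 * R)))) ≤ ENNReal.ofReal (K₁ * (1 + ‖x₀‖) ^ 2) := fun x₀ => by
    rw [← h9]
    have h := (eLpNorm_restrict_ball_mono (fun x => fderiv ℝ U x) 2 x₀ (by linarith : 9 * R ≤ 18 * R)).trans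
      ((hDU2 x₀).trans (ofReal_poly_le_of_le hK₁ (ht0 x₀) (by norm_num : 1 ≤ 2)))
    exact_mod_cast h
  obtain ⟨K₃, hK₃, hS4⟩ := exists_poly_bound_gns_fderiv hU (p := 2) (p' := 6) (by norm_num) (by norm_num)
    (by positivity : 0 < 3 * R) hK₂ hK₁ hD2U hDU9
  have hS4' : ∀ x₀ : (EuclideanSpace ℝ (Fin 3)), eLpNorm (fun x => fderiv ℝ U x) 6
      (volume.restrict (ball x₀ (3 * R))) ≤ ENNReal.ofReal (K₃ * (1 + ‖x₀‖) ^ 2) := fun x₀ => by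
    exact_mod_cast hS4 x₀
  -- collect, degree `3`
  set K : ℝ := max (max K₁ K₂) (max K₃ (max CU6 CU12)) with hKdef
  have hK1K : K₁ ≤ K := (le_max_left _ _).trans (le_max_left _ _)
  have hK2K : K₂ ≤ K := (le_max_right _ _).trans (le_max_left _ _)
  have hK3K : K₃ ≤ K := (le_max_left _ _).trans (le_max_right _ _)
  have hC6K : CU6 ≤ K := ((le_max_left _ _).trans (le_max_right _ _)).trans (le_max_right _ _)
  have hC12K : CU12 ≤ K := ((le_max_right _ _).trans (le_max_right _ _)).trans (le_max_right _ _)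
  refine ⟨K, hK₁.trans hK1K, fun x₀ => ⟨?_, ?_, ?_, ?_, ?_⟩⟩
  · refine ((eLpNorm_restrict_ball_mono _ _ x₀ (by linarith)).trans (hDU2 x₀)).trans
      ((ofReal_poly_le_of_le hK₁ (ht0 x₀) (by norm_num : 1 ≤ 3)).trans (ENNReal.ofReal_le_ofReal ?_))
    gcongr
  · exact (poly_zero_of_uniform hCU6 3 hCU60 x₀).trans (ENNReal.ofReal_le_ofReal (by gcongr))
  · exact ((hS3 x₀).1.trans (ofReal_poly_le_of_le hK₂ (ht0 x₀) (by norm_num : 2 ≤ 3))).trans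
      (ENNReal.ofReal_le_ofReal (by gcongr))
  · exact ((hS4' x₀).trans (ofReal_poly_le_of_le hK₃ (ht0 x₀) (by norm_num : 2 ≤ 3))).trans
      (ENNReal.ofReal_le_ofReal (by gcongr))
  · exact (poly_zero_of_uniform hCU12 3 hCU120 x₀).trans (ENNReal.ofReal_le_ofReal (by gcongr))

/-! ### Oscillation and growth of the pressure -/

/-- **`osc_{B̄(x₀,1)} P ≤ K (1 + |x₀|)⁶`** for a smooth bounded rotated profile (`ν > 0`, `a ≥ 0`,
`B` skew; port of `IsLerayProfile.exists_osc_pressure_le` at `q = ∞`): `P = h + p̃[θU]` on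
`B(x₀, 4)` with `|∇h| ≤ K(1 + |x₀|)` and `|p̃[θU]| ≤ K(1 + |x₀|)⁶` by the round. -/
theorem exists_osc_pressure_le_of_rotated (hU : ContDiff ℝ ∞ U) (hP2 : ContDiff ℝ 2 P)
    (hB : ∀ x, ⟪B x, x⟫ = 0) (hdiv : VectorCalculus.IsDivFree U)
    (heq : ∀ y, -(ν • (Δ U) y) + a • U y + a • fderiv ℝ U y y + (B (U y) - fderiv ℝ U y (B y)) +
      convect U U y + gradient P y = 0)
    (hν : 0 < ν) (ha : 0 ≤ a) {M : ℝ} (hM : ∀ y, ‖U y‖ ≤ M) :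
    ∃ K : ℝ, 0 ≤ K ∧ ∀ x₀ x : (EuclideanSpace ℝ (Fin 3)), ‖x - x₀‖ ≤ 1 →
      |P x - P x₀| ≤ K * (1 + ‖x₀‖) ^ 6 := by
  have hUc : Continuous U := hU.continuous
  have hUq : MemLp U ∞ volume := memLp_top_of_bound hUc.aestronglyMeasurable M (Eventually.of_forall hM)
  -- gradient bound at radius `1`, pressure input at radius `9000`
  obtain ⟨KG, hKG, hG⟩ := exists_local_pressure_bound_of_four_le_of_rotated hU hP2 hB hdiv heq hν.le ha
    one_pos (q := ∞) le_top hUq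
  obtain ⟨KP, hKP, hP⟩ := exists_local_pressure_bound_of_four_le_of_rotated hU hP2 hB hdiv heq hν.le ha
    (by norm_num : (0 : ℝ) < 9000) (q := ∞) le_top hUq
  set c : (EuclideanSpace ℝ (Fin 3)) → ℝ := fun x₀ => P x₀ - normalisedPressure
    (fun w : (EuclideanSpace ℝ (Fin 3)) => cutoff (4 * 9000) (w - x₀) • U w) x₀ with hc
  have hPc : ∀ x₀ : (EuclideanSpace ℝ (Fin 3)), eLpNorm (fun x => P x - c x₀) 2
      (volume.restrict (ball x₀ (1000 * 9))) ≤ ENNReal.ofReal (KP * (1 + ‖x₀‖)) := fun x₀ => by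
    rw [show (1000 : ℝ) * 9 = 9000 by norm_num]; exact (hP x₀).2
  -- the round with `R = 9`
  obtain ⟨KB, hKB, hBs⟩ := stokes_round_of_rotated stokes_interior_Lr_estimate_holds hU hP2 hB hdiv heq
    hν ha hM (by norm_num : (0 : ℝ) < 9) hKP hPc
  obtain ⟨CU2, hCU20, hCU2⟩ := exists_eLpNorm_restrict_ball_le_of_memLp hUc hUq (s := 2) (by norm_num)
    le_top (9 * 1)
  have hD2 : ∀ x₀ : (EuclideanSpace ℝ (Fin 3)), eLpNorm (fun x => iteratedFDeriv ℝ 2 U x) 2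
      (volume.restrict (ball x₀ (9 * 1))) ≤ ENNReal.ofReal (max KB CU2 * (1 + ‖x₀‖) ^ 3) := fun x₀ =>
    ((eLpNorm_restrict_ball_mono _ _ x₀ (by norm_num)).trans (hBs x₀).2.2.1).trans
      (ENNReal.ofReal_le_ofReal (by gcongr; exact le_max_left _ _))
  have hD6 : ∀ x₀ : (EuclideanSpace ℝ (Fin 3)), eLpNorm (fun x => fderiv ℝ U x) 6
      (volume.restrict (ball x₀ (9 * 1))) ≤ ENNReal.ofReal (max KB CU2 * (1 + ‖x₀‖) ^ 3) := fun x₀ =>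
    ((eLpNorm_restrict_ball_mono _ _ x₀ (by norm_num)).trans (hBs x₀).2.2.2.1).trans
      (ENNReal.ofReal_le_ofReal (by gcongr; exact le_max_left _ _))
  have hU12 : ∀ x₀ : (EuclideanSpace ℝ (Fin 3)), eLpNorm U 12 (volume.restrict (ball x₀ (9 * 1))) ≤
      ENNReal.ofReal (max KB CU2 * (1 + ‖x₀‖) ^ 3) := fun x₀ =>
    ((eLpNorm_restrict_ball_mono _ _ x₀ (by norm_num)).trans (hBs x₀).2.2.2.2).trans
      (ENNReal.ofReal_le_ofReal (by gcongr; exact le_max_left _ _))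
  have hD2' : ∀ x₀ : (EuclideanSpace ℝ (Fin 3)), eLpNorm (fun x => fderiv ℝ U x) 2
      (volume.restrict (ball x₀ (9 * 1))) ≤ ENNReal.ofReal (max KB CU2 * (1 + ‖x₀‖) ^ 3) := fun x₀ =>
    ((eLpNorm_restrict_ball_mono _ _ x₀ (by norm_num)).trans (hBs x₀).1).trans
      (ENNReal.ofReal_le_ofReal (by gcongr; exact le_max_left _ _))
  have hU2 : ∀ x₀ : (EuclideanSpace ℝ (Fin 3)), eLpNorm U 2 (volume.restrict (ball x₀ (9 * 1))) ≤
      ENNReal.ofReal (max KB CU2 * (1 + ‖x₀‖) ^ 3) := fun x₀ =>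
    (poly_zero_of_uniform hCU2 3 hCU20 x₀).trans (ENNReal.ofReal_le_ofReal (by gcongr; exact le_max_right _ _))
  obtain ⟨KN, hKN, hN⟩ := exists_poly_bound_sup_localPressure hU one_pos (le_max_of_le_left hKB) hD2 hD6
    hU12 hD2' hU2
  -- the oscillation
  refine ⟨KG + 2 * KN, by positivity, fun x₀ x hx => ?_⟩
  have ht : 0 ≤ ‖x₀‖ := norm_nonneg _
  set N : (EuclideanSpace ℝ (Fin 3)) → ℝ := normalisedPressure
    (fun w : (EuclideanSpace ℝ (Fin 3)) => cutoff (4 * 1) (w - x₀) • U w) with hNd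
  have hN2 : ContDiff ℝ 2 N := contDiff_normalisedPressure_locF hU one_pos (x₀ := x₀)
  have hh1 : ContDiff ℝ 1 (fun y => P y - N y) := (hP2.sub hN2).of_le one_le_two
  have hxmem : x ∈ closedBall x₀ 1 := by rwa [mem_closedBall, dist_eq_norm]
  have hmv : |(P x - N x) - (P x₀ - N x₀)| ≤ KG * (1 + ‖x₀‖) := by
    have h := (convex_closedBall x₀ 1).norm_image_sub_le_of_norm_fderiv_le (f := fun y => P y - N y)
      (fun z _ => (hh1.differentiable one_ne_zero z)) (hG x₀).1 (mem_closedBall_self zero_le_one) hxmem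
    rw [Real.norm_eq_abs] at h
    refine h.trans ?_
    calc KG * (1 + ‖x₀‖) * ‖x - x₀‖ ≤ KG * (1 + ‖x₀‖) * 1 := by gcongr
      _ = KG * (1 + ‖x₀‖) := mul_one _
  have hNx := hN x₀ x
  have hNx₀ := hN x₀ x₀
  have h16 : (1 + ‖x₀‖) ≤ (1 + ‖x₀‖) ^ 6 := le_self_pow₀ (by linarith) (by norm_num)
  have hsplit : P x - P x₀ = ((P x - N x) - (P x₀ - N x₀)) + (N x - N x₀) := by ring
  rw [hsplit]
  calc |((P x - N x) - (P x₀ - N x₀)) + (N x - N x₀)|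
      ≤ |(P x - N x) - (P x₀ - N x₀)| + |N x - N x₀| := abs_add_le _ _
    _ ≤ KG * (1 + ‖x₀‖) + (|N x| + |N x₀|) := add_le_add hmv (abs_sub _ _)
    _ ≤ KG * (1 + ‖x₀‖) ^ 6 + (KN * (1 + ‖x₀‖) ^ (3 + 3) + KN * (1 + ‖x₀‖) ^ (3 + 3)) := by
        gcongr
    _ = (KG + 2 * KN) * (1 + ‖x₀‖) ^ 6 := by ring

/-- **Polynomial growth of the pressure of a bounded rotated profile**: `|P(y)| ≤ C |y|⁷` for
`|y| ≥ 1` (chain the unit-ball oscillations along `[0, y]`; port of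
`IsLerayProfile.exists_pressure_growth`). -/
theorem exists_pressure_growth_of_rotated (hU : ContDiff ℝ ∞ U) (hP2 : ContDiff ℝ 2 P)
    (hB : ∀ x, ⟪B x, x⟫ = 0) (hdiv : VectorCalculus.IsDivFree U)
    (heq : ∀ y, -(ν • (Δ U) y) + a • U y + a • fderiv ℝ U y y + (B (U y) - fderiv ℝ U y (B y)) +
      convect U U y + gradient P y = 0)
    (hν : 0 < ν) (ha : 0 ≤ a) {M : ℝ} (hM : ∀ y, ‖U y‖ ≤ M) :
    ∃ (N : ℕ) (C R : ℝ), ∀ y : (EuclideanSpace ℝ (Fin 3)), R ≤ ‖y‖ → |P y| ≤ C * ‖y‖ ^ N := by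
  obtain ⟨K, hK, hosc⟩ := exists_osc_pressure_le_of_rotated hU hP2 hB hdiv heq hν ha hM
  have hincr := abs_sub_le_of_osc_le (f := P) one_pos hK (n := 6) (fun x₀ x hx => hosc x₀ x hx)
  simp only [div_one] at hincr
  obtain ⟨C, hC⟩ := exists_abs_le_mul_pow_of_increments (f := P) one_pos hK (n := 6)
    (fun y => by have := hincr y; rwa [div_one])
  exact ⟨7, C, 1, hC⟩

end Growth

/-- **Registered stub `stub_rssHeadGrowth`** of the skeleton of crux `CounterRotatingLiouville`
(line `tsai-rotating-head-chain`): the rotating head pressure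
`Π_B = ½|U|² + P + a⟨y,U⟩ − ⟨By,U⟩` of a smooth bounded rotated Leray profile (`ν, a > 0`, `B`
skew) is polynomially bounded, `|Π_B(y)| ≤ C (1 + |y|)^N` (Tsai's Lemma 3.2 for the rotated system
at `q = ∞`, plus `|⟨By, U⟩| ≤ ‖B‖ M |y|`). -/
theorem stub_rssHeadGrowth : ∀ (ν a : ℝ), 0 < ν → 0 < a → ∀ (B : EuclideanSpace ℝ (Fin 3) →L[ℝ] EuclideanSpace ℝ (Fin 3)) (U : EuclideanSpace ℝ (Fin 3) → EuclideanSpace ℝ (Fin 3)) (P : EuclideanSpace ℝ (Fin 3) → ℝ), ContDiff ℝ (⊤ : ℕ∞) U → ContDiff ℝ 2 P → (∀ x, inner ℝ (B x) x = 0) → Literature.Analysis.FluidPDE.VectorCalculus.IsDivFree U → (∀ y, -(ν • Laplacian.laplacian U y) + a • U y + a • fderiv ℝ U y y + (B (U y) - fderiv ℝ U y (B y)) + Literature.Analysis.FluidPDE.convect U U y + gradient P y = 0) → (∃ M : ℝ, ∀ y, ‖U y‖ ≤ M) → ∃ C : ℝ, ∃ N : ℕ, ∀ y, |(fun z => Literature.Analysis.FluidPDE.headPressure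 a U P z - inner ℝ (B z) (U z)) y| ≤ C * (1 + ‖y‖) ^ N := by
  intro ν a hν ha B U P hU hP hB hdiv heq hbdd
  obtain ⟨M, hM⟩ := hbdd
  have hM0 : 0 ≤ M := (norm_nonneg _).trans (hM 0)
  obtain ⟨N, C, R, hPR⟩ := exists_pressure_growth_of_rotated hU hP hB hdiv heq hν ha.le hM
  obtain ⟨C', hC'0, hC'⟩ := exists_poly_bound_of_eventually_le hP.continuous hPR
  have hUaff : ∀ y, ‖U y‖ ≤ M + 0 * ‖y‖ := fun y => by rw [zero_mul, add_zero]; exact hM y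
  have hhead := abs_headPressure_le ha.le le_rfl hM0 hC'0 hUaff hC'
  refine ⟨(2⁻¹ * (M + 0) ^ 2 + C' + a * (M + 0)) + ‖B‖ * M, N + 2, fun y => ?_⟩
  have h1 := hhead y
  have h2 : |⟪B y, U y⟫| ≤ ‖B‖ * M * (1 + ‖y‖) ^ (N + 2) := by
    have hy1 : ‖y‖ ≤ (1 + ‖y‖) ^ (N + 2) := by
      calc ‖y‖ ≤ 1 + ‖y‖ := by linarith [norm_nonneg y]
        _ ≤ (1 + ‖y‖) ^ (N + 2) := le_self_pow₀ (by linarith [norm_nonneg y]) (by omega)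
    calc |⟪B y, U y⟫| ≤ ‖B y‖ * ‖U y‖ := abs_real_inner_le_norm _ _
      _ ≤ (‖B‖ * ‖y‖) * M := mul_le_mul (B.le_opNorm y) (hM y) (norm_nonneg _) (by positivity)
      _ = ‖B‖ * M * ‖y‖ := by ring
      _ ≤ ‖B‖ * M * (1 + ‖y‖) ^ (N + 2) := by gcongr
  calc |headPressure a U P y - ⟪B y, U y⟫| ≤ |headPressure a U P y| + |⟪B y, U y⟫| := abs_sub _ _
    _ ≤ (2⁻¹ * (M + 0) ^ 2 + C' + a * (M + 0)) * (1 + ‖y‖) ^ (N + 2) +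
        ‖B‖ * M * (1 + ‖y‖) ^ (N + 2) := add_le_add h1 h2
    _ = ((2⁻¹ * (M + 0) ^ 2 + C' + a * (M + 0)) + ‖B‖ * M) * (1 + ‖y‖) ^ (N + 2) := by ring

end Summit.NavierStokesRegularity.NavierStokesRegularity.Theorems.CoriolisHead

end
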